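import Summits.AnomalousDissipation.AnomalousDissipation.Theorems.MomentParityPathField
import Summits.AnomalousDissipation.AnomalousDissipation.Theorems.MomentParityTimeAverages
import Literature.Analysis.FluidPDE.ZerothLaw
import Literature.Analysis.FluidPDE.LerayHopfMomentum

/-! # Route MomentParity · crux `GalerkinEnsembleRealization` — line `Sketch`, stub `stub_timeAverages`

From the integer-window means of the total energy `pathEnergyTot ω` and of the resolved
dissipation `pathDiss ν K ω` of a path `ω` of the trajectory space `𝒦 = pathSpace R L`
(`MomentParityDefs`) to the long-time means `meanEnergy u`, `meanDissipation ν u`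
(`Literature.Analysis.FluidPDE.ZerothLaw`) of a global Leray–Hopf field `u` realising the path
after a time shift `s ≥ 0`, i.e. `𝓕(u t)(k) = ω̄(s + t, k)` for `t ≥ 0`:

* energy: `∫ ‖u t‖² = pathEnergyTot ω (s + t)` (Parseval, `integral_norm_sq_pathField`), the
  integer-window means upgrade to `timeMean → e` (`tendsto_timeMean_of_nat`), survive the shift
  (`tendsto_timeMean_comp_add`), so `meanEnergy u = e`;
* dissipation: for a.e. `t ∈ (0, T)` the enstrophy `‖∇u(t)‖₂²` is finite (Leray–Hopf class,
  `IsLerayHopfOn.lintegral_eGradNormSq_lt_top`) and dominates the resolved dissipation of the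
  path (`pathDiss_le_mul_toReal_eGradNormSq`); the running means of `ν‖∇u‖₂²` are bounded
  (FMRT 2001 Ch. IV §3.1 (3.4), `IsGlobalLerayHopf.isBoundedUnder_timeMean_dissipation`), whence
  `D ≤ meanDissipation ν u` by the comparison principle `le_longTimeAvgSup_of_tendsto`
  (Doering–Foias 2002 §2 bookkeeping; stmt-AnomalousDissipation-11466, realisation step). -/

noncomputable section

-- every `Summit.AnomalousDissipation.AnomalousDissipation.…` name repeats the summit = sub-problem segment (D-0017 layout)
set_option linter.dupNamespace false

open MeasureTheory Set Filter Topology Function Metric UnitAddTorus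
open scoped BigOperators ENNReal InnerProductSpace RealInnerProductSpace

namespace Summit.AnomalousDissipation.AnomalousDissipation.Theorems.MomentParity

open Literature.Analysis.FunctionSpaces Literature.Analysis.FunctionSpaces.Torus
open Literature.Analysis.FluidPDE Literature.Analysis.FluidPDE.Torus

variable {ν : ℝ} {f : UnitAddTorus (Fin 3) → EuclideanSpace ℝ (Fin 3)}

/-- **Running means of the resolved dissipation of a realised path vs. the dissipation of the
field.** If `u` is Leray–Hopf on `[0, T)`, `T > 0`, `ν ≥ 0`, and `𝓕(u t) = ω̄(s + t, ·)` for
`t ≥ 0`, then `timeMean (pathDiss ν K ω (s + ·)) T ≤ timeMean (ν ‖∇u(·)‖₂²) T`. -/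
theorem timeMean_pathDiss_comp_add_le (hν : 0 ≤ ν) {ω : Path (Fin 3)} {s : ℝ}
    {u₀ : UnitAddTorus (Fin 3) → EuclideanSpace ℝ (Fin 3)}
    {u : ℝ → UnitAddTorus (Fin 3) → EuclideanSpace ℝ (Fin 3)} {T : ℝ} (hT : 0 < T)
    (hLH : IsLerayHopfOn T ν (fun _ => f) u₀ u)
    (hcoef : ∀ t, 0 ≤ t → ∀ k, mFourierCoeff (EuclideanSpace.complexify ∘ u t) k = pathExt ω (s + t) k)
    (K : ℕ) :
    timeMean (fun t => pathDiss ν K ω (s + t)) T ≤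
      timeMean (fun t => ν * (eGradNormSq (u t)).toReal) T := by
  have hmeas := hLH.aemeasurable_eGradNormSq
  have hfin := hLH.lintegral_eGradNormSq_lt_top
  have hlt : ∀ᵐ τ ∂(volume.restrict (Ioo 0 T)), eGradNormSq (u τ) < ⊤ := ae_lt_top' hmeas hfin.ne
  unfold timeMean
  rw [intervalIntegral.integral_of_le hT.le, intervalIntegral.integral_of_le hT.le,
    integral_Ioc_eq_integral_Ioo, integral_Ioc_eq_integral_Ioo]
  refine mul_le_mul_of_nonneg_left ?_ (inv_nonneg.2 hT.le)
  refine integral_mono_of_nonneg (ae_of_all _ fun t => pathDiss_nonneg hν K ω (s + t))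
    ((integrable_toReal_of_lintegral_ne_top hmeas hfin.ne).const_mul ν) ?_
  filter_upwards [hlt, ae_restrict_mem measurableSet_Ioo] with t ht hmem
  exact pathDiss_le_mul_toReal_eGradNormSq hν K (hcoef t hmem.1.le) ht.ne

/-- **Time averages of a realised path.** If a global Leray–Hopf solution realises the path
`ω ∈ 𝒦` after the shift `s ≥ 0` and the integer-window means of the total energy / resolved
dissipation of `ω` converge to `e` / `D`, then `meanEnergy u ≤ e` and `D ≤ meanDissipation ν u`. -/
theorem stub_timeAverages (hν : 0 < ν) (hf : IsSmooth f) (hf0 : HasZeroMean f) {R : ℝ}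
    {L : (Fin 3 → ℤ) → ℝ} {ω : Path (Fin 3)} (hω : ω ∈ pathSpace R L) {s : ℝ} (hs : 0 ≤ s)
    {u₀ : UnitAddTorus (Fin 3) → EuclideanSpace ℝ (Fin 3)}
    {u : ℝ → UnitAddTorus (Fin 3) → EuclideanSpace ℝ (Fin 3)}
    (hu : IsGlobalLerayHopf ν (fun _ => f) u₀ u)
    (hcoef : ∀ t, 0 ≤ t → MemLp (u t) 2 volume ∧
      ∀ k, mFourierCoeff (EuclideanSpace.complexify ∘ u t) k = pathExt ω (s + t) k)
    (K : ℕ) {e D : ℝ}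
    (he : Tendsto (fun n : ℕ => (n : ℝ)⁻¹ * ∫ t in (0 : ℝ)..n, pathEnergyTot ω t) atTop (𝓝 e))
    (hD : Tendsto (fun n : ℕ => (n : ℝ)⁻¹ * ∫ t in (0 : ℝ)..n, pathDiss ν K ω t) atTop (𝓝 D)) :
    meanEnergy u ≤ e ∧ D ≤ meanDissipation ν u := by
  -- ENERGY: integer windows → all windows → shifted windows → the field
  have hE1 : Tendsto (timeMean fun t => pathEnergyTot ω t) atTop (𝓝 e) :=
    tendsto_timeMean_of_nat (pathEnergyTot_nonneg ω) (intervalIntegrable_pathEnergyTot hω) he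
  have hE2 : Tendsto (timeMean fun t => pathEnergyTot ω (s + t)) atTop (𝓝 e) :=
    tendsto_timeMean_comp_add (intervalIntegrable_pathEnergyTot hω) hE1 hs
  have hEu : Tendsto (timeMean fun t => ∫ x, ‖u t x‖ ^ 2) atTop (𝓝 e) := by
    refine hE2.congr' ?_
    filter_upwards [eventually_ge_atTop 0] with T hT
    unfold timeMean
    congr 1
    refine intervalIntegral.integral_congr fun t ht => ?_
    rw [uIcc_of_le hT] at ht
    exact (integral_norm_sq_pathField hcoef ht.1).symm
  -- DISSIPATION: integer windows → all windows → shifted windows, then comparison with `ν‖∇u‖₂²`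
  have hD1 : Tendsto (timeMean fun t => pathDiss ν K ω t) atTop (𝓝 D) :=
    tendsto_timeMean_of_nat (pathDiss_nonneg hν.le K ω) (intervalIntegrable_pathDiss hω ν K) hD
  have hD2 : Tendsto (timeMean fun t => pathDiss ν K ω (s + t)) atTop (𝓝 D) :=
    tendsto_timeMean_comp_add (intervalIntegrable_pathDiss hω ν K) hD1 hs
  obtain ⟨B, hB⟩ := hu.isBoundedUnder_timeMean_dissipation hν (hf.memLp 2) hf0
  have hgh : ∀ᶠ T in atTop, timeMean (fun t => pathDiss ν K ω (s + t)) T ≤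
      timeMean (fun t => ν * (eGradNormSq (u t)).toReal) T := by
    filter_upwards [eventually_gt_atTop 0] with T hT
    exact timeMean_pathDiss_comp_add_le hν.le hT (hu T hT) (fun t ht => (hcoef t ht).2) K
  refine ⟨?_, ?_⟩
  · rw [meanEnergy_eq_longTimeAvgSup]
    exact (longTimeAvgSup_eq_of_tendsto hEu).le
  · unfold meanDissipation
    exact le_longTimeAvgSup_of_tendsto hD2 hgh (Filter.eventually_map.1 hB)

end Summit.AnomalousDissipation.AnomalousDissipation.Theorems.MomentParity
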